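import Summits.BirchSwinnertonDyer.BirchSwinnertonDyer.Theses.PrintX9
import Summits.BirchSwinnertonDyer.BirchSwinnertonDyer.Theses.PrintX10b
import Literature.NumberTheory.EllipticCurves.AnticyclotomicTowerSharpProofs
import HarnessLib

/-!
# Support item `AnticyclotomicTowerSharp` (stmt-BirchSwinnertonDyer-27076; binder `hTw` of `closes` on PrintX9 rev 50 and
# PrintX10b rev 48): Tower♯ `K_k ⊆ K[p^{k+1}]` CLOSED IN THE KERNEL on both routes

HONEST FRAMING (cell `run/shared/lean/pub/bsd-print-x9/`, seat bsd-line-x10b-p1 LEAD g10 on the Tower♯ board: (T-loc) p680094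
x9-p1-w4 g10 · (T-idele) p680643 x10b-p1-w2 g12 · (T-end) p680687 LEAD g10 / p681041 §2–§3 w2 g12 · letter p681041
`Literature.NumberTheory.EllipticCurves.anticyclotomicTowerSharp` w2 g12): THEOREMS ONLY, the two one-line item closers. The item
was filed «support, cite-only, CLASSICAL: derived» (Cox Thm. 7.24 / 11.1, Perrin-Riou 1987 §3.2); it is now an unconditional tree
theorem from the tree's class field theory (idèlic character of `κ`, the anticyclotomic sign, `1 + p^{k+1}𝒪 = (1 + p𝒪)^{p^k}`
for odd `p`, the splitting law of `K[p^{k+1}]`, Bauer, Krull–Galois). This discharges ONE of the ten by-name print leaves of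
each `closes`; the other nine remain cite-only HYPOTHESES; «beyond-print theorem»: NO. BSD is not proved by any of this; no summit
statement is proved by this seat.

* `anticyclotomicTowerSharp_holds : Theses.PrintX9.AnticyclotomicTowerSharp`
* `anticyclotomicTowerSharp_holds_X10b : Theses.PrintX10b.AnticyclotomicTowerSharp`
References: [Cox2013] Thm. 7.24, 9.2, 11.1; [PerrinRiou1987BSMF] §3.2; [NeukirchANT1999] VII (13.9); [CastellaGrossiLeeSkinner2022] §4.1.
-/

-- `Summit.BirchSwinnertonDyer.BirchSwinnertonDyer.…` repeats the summit name (single-conjunct summit)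
set_option linter.dupNamespace false
set_option autoImplicit false

noncomputable section

namespace Summit.BirchSwinnertonDyer.BirchSwinnertonDyer.Theorems.AnticyclotomicTowerSharpClosed

/-- **Row 9's print leaf `hTw` (stmt-BirchSwinnertonDyer-27076) IS A THEOREM**: `Theses.PrintX9.AnticyclotomicTowerSharp` — for
`K` imaginary quadratic, `p` odd, `κ` anticyclotomic, all `jbar`, `k`: `Gal(K̄/K[p^{k+1}]) ≤ Gal(K̄/K_k)`.
Proof: `Literature.NumberTheory.EllipticCurves.anticyclotomicTowerSharp` (p681041). [cite: Cox2013, §7.D Thm. 7.24 and §11.A Thm. 11.1]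
[cite: PerrinRiou1987BSMF, §3.2] -/
theorem anticyclotomicTowerSharp_holds :
    Summit.BirchSwinnertonDyer.BirchSwinnertonDyer.Theses.PrintX9.AnticyclotomicTowerSharp :=
  Literature.NumberTheory.EllipticCurves.anticyclotomicTowerSharp

/-- **Row 10's print leaf `hTw` (stmt-BirchSwinnertonDyer-27076) IS A THEOREM**: `Theses.PrintX10b.AnticyclotomicTowerSharp`
(the PrintX10b twin; the two route decls are the same `∀`-statement).
Proof: `Literature.NumberTheory.EllipticCurves.anticyclotomicTowerSharp` (p681041). [cite: Cox2013, §7.D Thm. 7.24 and §11.A Thm. 11.1]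
[cite: PerrinRiou1987BSMF, §3.2] -/
theorem anticyclotomicTowerSharp_holds_X10b :
    Summit.BirchSwinnertonDyer.BirchSwinnertonDyer.Theses.PrintX10b.AnticyclotomicTowerSharp :=
  Literature.NumberTheory.EllipticCurves.anticyclotomicTowerSharp

end Summit.BirchSwinnertonDyer.BirchSwinnertonDyer.Theorems.AnticyclotomicTowerSharpClosed

end
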